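import Mathlib

/-!
# LINE L1 (t4-L1-p1) — C7.1 / C7.1∞ (the local fibration over the stabiliser): the topological half

`Tier4/Line1/OrbitLifting.lean`.  Field-free, `import Mathlib` only.

p4's C7 census (S12903) proves the adelic fibration C7 from local fibrations at every place: for a non-zero rational
`v₀` and a compact `C ⊆ k_v⁴`, `{h ∈ U(W)(k_v) : v₀ h ∈ C} ⊆ Stab_v(v₀) · K` with `K ⊆ U(W)(k_v)` compact
(`exists_compact_local_stab_mul_fin`, `…_inf`).  This module proves the TOPOLOGICAL half of that statement once, for
an arbitrary locally compact group `G` and an arbitrary OPEN orbit map `φ : G → X`: a compact `C` inside the orbit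
lifts to a compact `K ⊆ G`, and then every `h` with `φ h ∈ C` factors as `h = s * κ` with `s` in the stabiliser and
`κ ∈ K`.  The open-mapping theorem for σ-compact groups acting transitively on Baire spaces (Mathlib's
`isOpenMap_smul_of_sigmaCompact`) supplies the openness; what remains of C7.1 / C7.1∞ is the TRANSITIVITY of the local
unitary group on the sphere `{x : h(x, x) = h(v₀, v₀)}` (local Witt) together with the bookkeeping that `U(W)(k_v)` is a
σ-compact locally compact topological group acting continuously on that closed sphere.

HC_CM is NOT proved by anyone in this repository.
-/

namespace Summit.Ventures.HodgeRepro.Tier4.Line1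

open Topology

/-- **Compacts in the image of an open map lift to compacts.**  `G` locally compact, `φ : G → X` open, `C ⊆ X`
compact and contained in the range of `φ`: then `C ⊆ φ '' K` for a compact `K ⊆ G`.  Proof: for every `c ∈ C`
pick a preimage `g c` and a compact neighbourhood `N c` of it; the open sets `φ '' interior (N c)` cover `C`;
take a finite subcover and let `K` be the union of the corresponding `N c`. -/
theorem exists_compact_subset_image_of_isOpenMap {G X : Type*} [TopologicalSpace G] [LocallyCompactSpace G]
    [TopologicalSpace X] {φ : G → X} (hφ : IsOpenMap φ) {C : Set X} (hC : IsCompact C)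
    (hCr : C ⊆ Set.range φ) : ∃ K : Set G, IsCompact K ∧ C ⊆ φ '' K := by
  classical
  have hpre : ∀ c : C, ∃ g : G, φ g = c := fun c => hCr c.2
  choose g hg using hpre
  have hN : ∀ c : C, ∃ N : Set G, IsCompact N ∧ N ∈ 𝓝 (g c) := fun c => exists_compact_mem_nhds (g c)
  choose N hNc hNn using hN
  have hcov : C ⊆ ⋃ c : C, φ '' interior (N c) := by
    intro x hx
    refine Set.mem_iUnion.2 ⟨⟨x, hx⟩, ?_⟩
    exact ⟨g ⟨x, hx⟩, mem_interior_iff_mem_nhds.2 (hNn ⟨x, hx⟩), hg ⟨x, hx⟩⟩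
  obtain ⟨t, ht⟩ := hC.elim_finite_subcover (fun c : C => φ '' interior (N c))
    (fun c => hφ _ isOpen_interior) hcov
  refine ⟨⋃ c ∈ t, N c, t.isCompact_biUnion (fun c _ => hNc c), ?_⟩
  intro x hx
  obtain ⟨c, hct, hxc⟩ := Set.mem_iUnion₂.1 (ht hx)
  obtain ⟨y, hy, rfl⟩ := hxc
  exact ⟨y, Set.mem_iUnion₂.2 ⟨c, hct, interior_subset hy⟩, rfl⟩

/-- **The fibration over the stabiliser, abstract form.**  `G` a locally compact group, `φ : G → X` an open map
obeying the stabiliser rule `φ g = φ κ → φ (g * κ⁻¹) = φ 1` (true for every right orbit map `g ↦ v₀ ᵥ* g`), `C ⊆ X`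
compact inside the range of `φ`: there is a compact `K ⊆ G` such that every `h` with `φ h ∈ C` is `s * κ` with
`φ s = φ 1` (`s` in the stabiliser of the base point `φ 1`) and `κ ∈ K`. -/
theorem exists_compact_stab_mul_of_isOpenMap {G X : Type*} [TopologicalSpace G] [LocallyCompactSpace G]
    [Group G] [TopologicalSpace X] {φ : G → X} (hφ : IsOpenMap φ)
    (hstab : ∀ g κ : G, φ g = φ κ → φ (g * κ⁻¹) = φ 1) {C : Set X} (hC : IsCompact C)
    (hCr : C ⊆ Set.range φ) :
    ∃ K : Set G, IsCompact K ∧ ∀ h : G, φ h ∈ C → ∃ s : G, φ s = φ 1 ∧ ∃ κ ∈ K, h = s * κ := by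
  obtain ⟨K, hK, hCK⟩ := exists_compact_subset_image_of_isOpenMap hφ hC hCr
  refine ⟨K, hK, fun h hh => ?_⟩
  obtain ⟨κ, hκK, hκ⟩ := hCK hh
  exact ⟨h * κ⁻¹, hstab h κ hκ.symm, κ, hκK, by simp⟩

/-- **The fibration for a right action given by its multiplication law.**  `ψ : X → G → X` with `ψ x 1 = x` and
`ψ (ψ x g) κ = ψ x (g * κ)` (the laws of `Matrix.vecMul`: `vecMul_one`, `vecMul_vecMul`), base point `x₀`, the orbit
map `g ↦ ψ x₀ g` open, `C` compact inside the orbit: every `h` with `ψ x₀ h ∈ C` is `s * κ` with `ψ x₀ s = x₀` and `κ`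
in a compact `K` depending only on `C`. -/
theorem exists_compact_stab_mul_of_isOpenMap_right {G X : Type*} [TopologicalSpace G] [LocallyCompactSpace G]
    [Group G] [TopologicalSpace X] (ψ : X → G → X) (hψ1 : ∀ x, ψ x 1 = x)
    (hψm : ∀ x g κ, ψ (ψ x g) κ = ψ x (g * κ)) (x₀ : X) (hφ : IsOpenMap (fun g : G => ψ x₀ g))
    {C : Set X} (hC : IsCompact C) (hCr : C ⊆ Set.range (fun g : G => ψ x₀ g)) :
    ∃ K : Set G, IsCompact K ∧ ∀ h : G, ψ x₀ h ∈ C → ∃ s : G, ψ x₀ s = x₀ ∧ ∃ κ ∈ K, h = s * κ := by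
  have hstab : ∀ g κ : G, ψ x₀ g = ψ x₀ κ → ψ x₀ (g * κ⁻¹) = ψ x₀ 1 := by
    intro g κ hgκ
    rw [← hψm, hgκ, hψm, mul_inv_cancel]
  obtain ⟨K, hK, hK'⟩ := exists_compact_stab_mul_of_isOpenMap hφ hstab hC hCr
  refine ⟨K, hK, fun h hh => ?_⟩
  obtain ⟨s, hs, κ, hκK, hκ⟩ := hK' h hh
  exact ⟨s, by rw [hs, hψ1], κ, hκK, hκ⟩

/-- **The fibration from the open-mapping theorem** (left actions).  A σ-compact locally compact group `G` acting
continuously and transitively on a Baire `T2` space `X` (for instance a locally compact Hausdorff sphere); the orbit map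
of `x₀` is open (`isOpenMap_smul_of_sigmaCompact`), so every compact `C ⊆ X` lifts: every `h` with `h • x₀ ∈ C` is
`κ * s` with `κ` in a compact `K` and `s • x₀ = x₀`. -/
theorem exists_compact_mul_stab_of_pretransitive {G X : Type*} [TopologicalSpace G] [Group G]
    [IsTopologicalGroup G] [LocallyCompactSpace G] [SigmaCompactSpace G] [TopologicalSpace X] [BaireSpace X]
    [T2Space X] [MulAction G X] [ContinuousSMul G X] [MulAction.IsPretransitive G X] (x₀ : X) {C : Set X}
    (hC : IsCompact C) :
    ∃ K : Set G, IsCompact K ∧ ∀ h : G, h • x₀ ∈ C → ∃ κ ∈ K, ∃ s : G, s • x₀ = x₀ ∧ h = κ * s := by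
  have hopen : IsOpenMap (fun g : G => g • x₀) := isOpenMap_smul_of_sigmaCompact x₀
  have hCr : C ⊆ Set.range (fun g : G => g • x₀) := fun c _ => by
    obtain ⟨g, hg⟩ := MulAction.exists_smul_eq G x₀ c
    exact ⟨g, hg⟩
  obtain ⟨K, hK, hCK⟩ := exists_compact_subset_image_of_isOpenMap hopen hC hCr
  refine ⟨K, hK, fun h hh => ?_⟩
  obtain ⟨κ, hκK, hκ⟩ := hCK hh
  refine ⟨κ, hκK, κ⁻¹ * h, ?_, by simp⟩
  have hκ' : κ • x₀ = h • x₀ := hκ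
  rw [mul_smul, ← hκ', inv_smul_smul]

end Summit.Ventures.HodgeRepro.Tier4.Line1
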